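import Mathlib.LinearAlgebra.StdBasis
import Literature.Analysis.Convexity.LatticeRefinement
import HarnessLib

/-!
# The canonical coordinate realisation of a finite simplicial complex

A finite geometric simplicial complex `K` in a real vector space `V` is the homeomorphic linear
image of a *coordinate complex* (`Literature.Analysis.Convexity.IsCoordinate`): enumerate the
vertices `vtx : Fin N → V`, let `π x = ∑ x i • vtx i` (`Fintype.linearCombination ℝ vtx`), and
take the coordinate simplices on the index sets of the faces.  We construct this coordinate
complex (`canonical K vtx hinj hrange`) and prove: its faces correspond to the faces of `K`
(`mem_canonical_faces`, `image_coordSimplex_idx`), `π` maps each closed coordinate simplex onto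
the corresponding closed simplex of `K` (`image_convexHull_coordSimplex`) and is **injective on
the underlying space** (`injOn_canonical_space` — this uses that `K` is a complex: hulls meet in
the hull of the common face, plus uniqueness of barycentric coordinates), with
`π '' space = K.space` (`image_canonical_space`); `exists_vertex_enumeration` supplies the
enumeration.  This is the "re-canonicalisation" step that lets the lattice subdivision
`latticeRefinement` be applied to an arbitrary finite complex (Munkres (1966), proof of 9.4: "the
complex `K` is isomorphic to a subcomplex of some standard simplex").
No named facts are introduced. [folklore]
-/

open Set Function

noncomputable section

namespace Literature.Analysis.Convexity

variable {N : ℕ}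

/-! ### Coordinate simplices on index sets -/

section Coord

/-- The coordinate simplex of an index set: the coordinate vectors `e i`, `i ∈ I`. [folklore] -/
def coordSimplex (I : Finset (Fin N)) : Finset (Fin N → ℝ) :=
  I.image fun i => (Pi.single i 1 : Fin N → ℝ)

/-- Coordinate vectors are injective in the index. [folklore] -/
theorem single_one_injective : Injective fun i : Fin N => (Pi.single i 1 : Fin N → ℝ) := by
  intro i j h
  by_contra hij
  have := congrFun h i
  simp only [Pi.single_eq_same, Pi.single_eq_of_ne hij] at this
  exact one_ne_zero this

/-- Membership in a coordinate simplex. [folklore] -/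
theorem mem_coordSimplex_iff {I : Finset (Fin N)} {v : Fin N → ℝ} :
    v ∈ coordSimplex I ↔ ∃ i ∈ I, Pi.single i 1 = v := by
  simp [coordSimplex]

/-- `e i` lies in the coordinate simplex of `I` iff `i ∈ I`. [folklore] -/
theorem single_mem_coordSimplex_iff {I : Finset (Fin N)} {i : Fin N} :
    (Pi.single i 1 : Fin N → ℝ) ∈ coordSimplex I ↔ i ∈ I := by
  rw [mem_coordSimplex_iff]
  constructor
  · rintro ⟨j, hj, hji⟩
    rwa [← single_one_injective hji]
  · exact fun hi => ⟨i, hi, rfl⟩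

/-- Coordinate simplices commute with intersections. [folklore] -/
theorem coordSimplex_inter (I J : Finset (Fin N)) :
    coordSimplex (I ∩ J) = coordSimplex I ∩ coordSimplex J := by
  classical
  unfold coordSimplex
  convert Finset.image_inter I J single_one_injective

/-- Coordinate simplices are monotone and injective in the index set. [folklore] -/
theorem coordSimplex_subset_iff {I J : Finset (Fin N)} : coordSimplex I ⊆ coordSimplex J ↔ I ⊆ J := by
  constructor
  · intro h i hi
    exact single_mem_coordSimplex_iff.1 (h (single_mem_coordSimplex_iff.2 hi))
  · exact fun h => Finset.image_subset_image h

/-- The closed coordinate simplex is the standard face. [folklore] -/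
theorem convexHull_coordSimplex (I : Finset (Fin N)) :
    convexHull ℝ ((coordSimplex I : Finset (Fin N → ℝ)) : Set (Fin N → ℝ)) = stdFace (I : Set (Fin N)) :=
  convexHull_image_single I

/-- Coordinate simplices are affinely independent. [folklore] -/
theorem affineIndependent_coordSimplex (I : Finset (Fin N)) :
    AffineIndependent ℝ ((↑) : ↥(coordSimplex I) → (Fin N → ℝ)) := by
  classical
  have h := (Pi.linearIndependent_single_one (Fin N) ℝ).affineIndependent.range
  refine h.mono ?_
  intro v hv
  obtain ⟨i, -, rfl⟩ := mem_coordSimplex_iff.1 (Finset.mem_coe.1 hv)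
  exact ⟨i, rfl⟩

/-- A nonempty subset of a coordinate simplex is a coordinate simplex. [folklore] -/
theorem exists_eq_coordSimplex_of_subset {I : Finset (Fin N)} {t : Finset (Fin N → ℝ)}
    (ht : t ⊆ coordSimplex I) :
    ∃ J ⊆ I, t = coordSimplex J := by
  classical
  refine ⟨I.filter fun i => (Pi.single i 1 : Fin N → ℝ) ∈ t, Finset.filter_subset _ _, ?_⟩
  ext v
  rw [mem_coordSimplex_iff]
  constructor
  · intro hv
    obtain ⟨i, hi, rfl⟩ := mem_coordSimplex_iff.1 (ht hv)
    exact ⟨i, Finset.mem_filter.2 ⟨hi, hv⟩, rfl⟩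
  · rintro ⟨i, hi, rfl⟩
    exact (Finset.mem_filter.1 hi).2

end Coord

/-! ### Index sets of a vertex enumeration -/

section Idx

variable {V : Type*} (vtx : Fin N → V)

/-- The index set of a face with respect to the vertex enumeration `vtx`. [folklore] -/
def idx (s : Finset V) : Finset (Fin N) := by
  classical
  exact Finset.univ.filter fun i => vtx i ∈ s

variable {vtx}

/-- Membership in the index set. [folklore] -/
theorem mem_idx_iff {s : Finset V} {i : Fin N} : i ∈ idx vtx s ↔ vtx i ∈ s := by
  classical
  simp [idx]

/-- The index set is monotone. [folklore] -/
theorem idx_mono {s s' : Finset V} (h : s ⊆ s') : idx vtx s ⊆ idx vtx s' := fun _ hi =>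
  mem_idx_iff.2 (h (mem_idx_iff.1 hi))

/-- With an injective enumeration covering the vertices, a face is the image of its index set.
[folklore] -/
theorem image_vtx_idx [DecidableEq V] {s : Finset V} (hs : ∀ v ∈ s, ∃ i, vtx i = v) :
    (idx vtx s).image vtx = s := by
  ext v
  simp only [Finset.mem_image, mem_idx_iff]
  constructor
  · rintro ⟨i, hi, rfl⟩; exact hi
  · intro hv
    obtain ⟨i, rfl⟩ := hs v hv
    exact ⟨i, hv, rfl⟩

/-- The index set of the image of an index set. [folklore] -/
theorem idx_image_vtx [DecidableEq V] (hinj : Injective vtx) (J : Finset (Fin N)) :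
    idx vtx (J.image vtx) = J := by
  ext i
  rw [mem_idx_iff, Finset.mem_image]
  constructor
  · rintro ⟨j, hj, hji⟩
    rwa [← hinj hji]
  · exact fun hi => ⟨i, hi, rfl⟩

end Idx

/-! ### The canonical complex of a vertex enumeration -/

section Canonical

variable {V : Type*} [AddCommGroup V] [Module ℝ V] (K : Geometry.SimplicialComplex ℝ V)
  (vtx : Fin N → V)

/-- **The canonical coordinate complex** of `K` for the vertex enumeration `vtx`: the coordinate
simplices on the index sets of the faces of `K`. [folklore] -/
def canonical (hinj : Injective vtx) (hrange : ∀ s ∈ K.faces, ∀ v ∈ s, ∃ i, vtx i = v) :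
    Geometry.SimplicialComplex ℝ (Fin N → ℝ) where
  faces := {t | ∃ s ∈ K.faces, coordSimplex (idx vtx s) = t}
  isRelLowerSet_faces := by
    classical
    rintro _ ⟨s, hs, rfl⟩
    refine ⟨?_, fun t ht hne => ?_⟩
    · obtain ⟨v, hv⟩ := K.nonempty_of_mem_faces hs
      obtain ⟨i, rfl⟩ := hrange s hs v hv
      exact ⟨Pi.single i 1, single_mem_coordSimplex_iff.2 (mem_idx_iff.2 hv)⟩
    · obtain ⟨J, hJ, rfl⟩ := exists_eq_coordSimplex_of_subset ht
      have hJne : J.Nonempty := by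
        obtain ⟨v, hv⟩ := hne
        obtain ⟨i, hi, rfl⟩ := mem_coordSimplex_iff.1 hv
        exact ⟨i, hi⟩
      refine ⟨J.image vtx, K.down_closed hs (fun v hv => ?_) (hJne.image vtx), ?_⟩
      · obtain ⟨i, hi, rfl⟩ := Finset.mem_image.1 hv
        exact mem_idx_iff.1 (hJ hi)
      · rw [idx_image_vtx hinj]
  indep := by
    rintro _ ⟨s, -, rfl⟩
    exact affineIndependent_coordSimplex _
  inter_subset_convexHull := by
    classical
    rintro _ _ ⟨s, -, rfl⟩ ⟨s', -, rfl⟩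
    rw [convexHull_coordSimplex, convexHull_coordSimplex, ← Finset.coe_inter, ← coordSimplex_inter,
      convexHull_coordSimplex]
    rintro x ⟨hx, hx'⟩
    refine ⟨hx.1, hx.2.1, fun i hi => ?_⟩
    rw [Finset.coe_inter, Set.mem_inter_iff] at hi
    by_cases h : i ∈ (idx vtx s : Set (Fin N))
    · exact hx'.2.2 i fun h' => hi ⟨h, h'⟩
    · exact hx.2.2 i h

variable {K vtx} {hinj : Injective vtx} {hrange : ∀ s ∈ K.faces, ∀ v ∈ s, ∃ i, vtx i = v}

/-- The faces of the canonical complex. [folklore] -/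
theorem mem_canonical_faces {t : Finset (Fin N → ℝ)} :
    t ∈ (canonical K vtx hinj hrange).faces ↔ ∃ s ∈ K.faces, coordSimplex (idx vtx s) = t := Iff.rfl

/-- The canonical complex is a coordinate complex. [folklore] -/
theorem isCoordinate_canonical : IsCoordinate (canonical K vtx hinj hrange) := by
  rintro _ ⟨s, -, rfl⟩ v hv
  obtain ⟨i, -, rfl⟩ := mem_coordSimplex_iff.1 hv
  exact ⟨i, rfl⟩

/-- The canonical complex is finite if `K` is. [folklore] -/
theorem canonical_faces_finite (hfin : K.faces.Finite) : (canonical K vtx hinj hrange).faces.Finite := by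
  have : (canonical K vtx hinj hrange).faces = (fun s => coordSimplex (idx vtx s)) '' K.faces := by
    ext t; simp [mem_canonical_faces, eq_comm]
  rw [this]
  exact hfin.image _

/-! ### The realisation map -/

/-- The realisation map `π x = ∑ x i • vtx i`. [folklore] -/
abbrev real (vtx : Fin N → V) : (Fin N → ℝ) →ₗ[ℝ] V := Fintype.linearCombination ℝ vtx

/-- `π (e i) = vtx i`. [folklore] -/
theorem real_single (i : Fin N) : real vtx (Pi.single i 1) = vtx i := by
  classical
  rw [real, Fintype.linearCombination_apply_single, one_smul]

/-- The realisation of the coordinate simplex of a vertex set covered by the enumeration is that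
set. [folklore] -/
theorem image_real_coordSimplex_idx [DecidableEq V] {s : Finset V} (hs : ∀ v ∈ s, ∃ i, vtx i = v) :
    (coordSimplex (idx vtx s)).image (real vtx) = s := by
  rw [coordSimplex, Finset.image_image]
  have : (⇑(real vtx) ∘ fun i : Fin N => (Pi.single i 1 : Fin N → ℝ)) = vtx := by
    funext i; exact real_single i
  rw [this]
  exact image_vtx_idx hs

/-- The realisation maps closed coordinate simplices onto the corresponding closed simplices.
[folklore] -/
theorem image_real_convexHull [DecidableEq V] {s : Finset V} (hs : ∀ v ∈ s, ∃ i, vtx i = v) :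
    real vtx '' convexHull ℝ ((coordSimplex (idx vtx s) : Finset (Fin N → ℝ)) : Set (Fin N → ℝ)) =
      convexHull ℝ (s : Set V) := by
  rw [LinearMap.image_convexHull, ← Finset.coe_image, image_real_coordSimplex_idx hs]

/-- The realisation of a point of a standard face, as a combination of the vertices of the
corresponding face. [folklore] -/
theorem real_eq_sum_of_mem_stdFace [DecidableEq V] (hinj : Injective vtx) {s : Finset V}
    (hs : ∀ v ∈ s, ∃ i, vtx i = v) {x : Fin N → ℝ}
    (hx : x ∈ stdFace ((idx vtx s : Finset (Fin N)) : Set (Fin N)))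
    (W : V → ℝ) (hW : ∀ i, vtx i ∈ s → W (vtx i) = x i) :
    real vtx x = ∑ v ∈ s, W v • v ∧ ∑ v ∈ s, W v = ∑ i, x i := by
  have hzero : ∀ i, i ∉ idx vtx s → x i = 0 := fun i hi => hx.2.2 i (by simpa using hi)
  have himg := image_vtx_idx (vtx := vtx) hs
  constructor
  · have h1 : ∑ v ∈ (idx vtx s).image vtx, W v • v = ∑ i ∈ idx vtx s, W (vtx i) • vtx i :=
      Finset.sum_image fun i _ j _ h => hinj h
    rw [himg] at h1
    rw [h1, real, Fintype.linearCombination_apply,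
      ← Finset.sum_subset (Finset.subset_univ (idx vtx s)) (fun i _ hi => by rw [hzero i hi, zero_smul])]
    exact Finset.sum_congr rfl fun i hi => by rw [hW i (mem_idx_iff.1 hi)]
  · have h1 : ∑ v ∈ (idx vtx s).image vtx, W v = ∑ i ∈ idx vtx s, W (vtx i) :=
      Finset.sum_image fun i _ j _ h => hinj h
    rw [himg] at h1
    rw [h1, ← Finset.sum_subset (Finset.subset_univ (idx vtx s)) (fun i _ hi => hzero i hi)]
    exact Finset.sum_congr rfl fun i hi => hW i (mem_idx_iff.1 hi)

/-- **The realisation is injective on the underlying space of the canonical complex.**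
[folklore] -/
theorem injOn_real_canonical_space [DecidableEq V] :
    InjOn (real vtx) (canonical K vtx hinj hrange).space := by
  classical
  intro x hx y hy hxy
  obtain ⟨_, ⟨s, hs, rfl⟩, hxs⟩ := Geometry.SimplicialComplex.mem_space_iff.1 hx
  obtain ⟨_, ⟨s', hs', rfl⟩, hys'⟩ := Geometry.SimplicialComplex.mem_space_iff.1 hy
  rw [convexHull_coordSimplex] at hxs hys'
  -- the common image point lies in the hull of the common face
  have hps : real vtx x ∈ convexHull ℝ (s : Set V) := by
    rw [← image_real_convexHull (hrange s hs)]
    exact ⟨x, by rwa [convexHull_coordSimplex], rfl⟩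
  have hps' : real vtx x ∈ convexHull ℝ (s' : Set V) := by
    rw [hxy, ← image_real_convexHull (hrange s' hs')]
    exact ⟨y, by rwa [convexHull_coordSimplex], rfl⟩
  have hpi : real vtx x ∈ convexHull ℝ (↑(s ∩ s') : Set V) := by
    rw [Finset.coe_inter]
    exact K.inter_subset_convexHull hs hs' ⟨hps, hps'⟩
  obtain ⟨w, -, hw1, hwp⟩ := Finset.mem_convexHull'.1 hpi
  -- weights on the common face, extended by zero
  let Wc : V → ℝ := fun v => if v ∈ s ∩ s' then w v else 0
  have hWc_in : ∀ v ∈ s ∩ s', Wc v = w v := fun v hv => if_pos hv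
  have hWc_out : ∀ v ∉ s ∩ s', Wc v = 0 := fun v hv => if_neg hv
  have hWc_sum : ∀ {r : Finset V}, s ∩ s' ⊆ r → ∑ v ∈ r, Wc v = 1 := fun {r} hr => by
    rw [← Finset.sum_subset hr (fun v _ hv => hWc_out v hv), ← hw1]
    exact Finset.sum_congr rfl fun v hv => hWc_in v hv
  have hWc_comb : ∀ {r : Finset V}, s ∩ s' ⊆ r → ∑ v ∈ r, Wc v • v = real vtx x := fun {r} hr => by
    rw [← Finset.sum_subset hr (fun v _ hv => by rw [hWc_out v hv, zero_smul]), ← hwp]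
    exact Finset.sum_congr rfl fun v hv => by rw [hWc_in v hv]
  -- the coordinates of `x` and `y` are the extended weights
  have hsum1 : ∑ i, x i = 1 := hxs.2.1
  have hsum1' : ∑ i, y i = 1 := hys'.2.1
  -- weights of `x` as a function on `V`
  set Wx : V → ℝ := fun v => if h : ∃ i, vtx i = v then x h.choose else 0 with hWx
  have hWxv : ∀ i, Wx (vtx i) = x i := fun i => by
    have h : ∃ j, vtx j = vtx i := ⟨i, rfl⟩
    simp only [hWx, dif_pos h]
    rw [hinj h.choose_spec]
  set Wy : V → ℝ := fun v => if h : ∃ i, vtx i = v then y h.choose else 0 with hWy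
  have hWyv : ∀ i, Wy (vtx i) = y i := fun i => by
    have h : ∃ j, vtx j = vtx i := ⟨i, rfl⟩
    simp only [hWy, dif_pos h]
    rw [hinj h.choose_spec]
  obtain ⟨hx1, hx2⟩ := real_eq_sum_of_mem_stdFace hinj (hrange s hs) hxs Wx fun i _ => hWxv i
  obtain ⟨hy1, hy2⟩ := real_eq_sum_of_mem_stdFace hinj (hrange s' hs') hys' Wy fun i _ => hWyv i
  have hex : ∀ v ∈ s, Wx v = Wc v :=
    (K.indep hs).eq_of_sum_eq_sum_subtype (by rw [hx2, hsum1, hWc_sum Finset.inter_subset_left])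
      (by rw [← hx1, hWc_comb Finset.inter_subset_left])
  have hey : ∀ v ∈ s', Wy v = Wc v :=
    (K.indep hs').eq_of_sum_eq_sum_subtype (by rw [hy2, hsum1', hWc_sum Finset.inter_subset_right])
      (by rw [← hy1, hWc_comb Finset.inter_subset_right]; exact hxy.symm)
  -- conclude coordinatewise
  funext i
  have hxi : x i = Wc (vtx i) := by
    by_cases h : vtx i ∈ s
    · rw [← hWxv i, hex _ h]
    · have : x i = 0 := hxs.2.2 i (by simpa [mem_idx_iff] using h)
      rw [this, hWc_out _ fun h' => h (Finset.mem_inter.1 h').1]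
  have hyi : y i = Wc (vtx i) := by
    by_cases h : vtx i ∈ s'
    · rw [← hWyv i, hey _ h]
    · have : y i = 0 := hys'.2.2 i (by simpa [mem_idx_iff] using h)
      rw [this, hWc_out _ fun h' => h (Finset.mem_inter.1 h').2]
  rw [hxi, hyi]

/-- The realisation maps the underlying space of the canonical complex onto that of `K`.
[folklore] -/
theorem image_real_canonical_space [DecidableEq V] :
    real vtx '' (canonical K vtx hinj hrange).space = K.space := by
  refine Subset.antisymm ?_ ?_
  · rintro _ ⟨x, hx, rfl⟩
    obtain ⟨_, ⟨s, hs, rfl⟩, hxs⟩ := Geometry.SimplicialComplex.mem_space_iff.1 hx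
    refine K.convexHull_subset_space hs ?_
    rw [← image_real_convexHull (hrange s hs)]
    exact ⟨x, hxs, rfl⟩
  · intro p hp
    obtain ⟨s, hs, hps⟩ := Geometry.SimplicialComplex.mem_space_iff.1 hp
    rw [← image_real_convexHull (hrange s hs)] at hps
    obtain ⟨x, hx, rfl⟩ := hps
    exact ⟨x, Geometry.SimplicialComplex.convexHull_subset_space (mem_canonical_faces.2 ⟨s, hs, rfl⟩) hx, rfl⟩

end Canonical

/-! ### Vertex enumerations -/

section Enumeration

variable {V : Type*} [AddCommGroup V] [Module ℝ V]

/-- **Vertex enumerations exist.** A finite complex has an injective enumeration of a finite set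
containing all its vertices by some `Fin N`. [folklore] -/
theorem exists_vertex_enumeration {K : Geometry.SimplicialComplex ℝ V} (hfin : K.faces.Finite) :
    ∃ (N : ℕ) (vtx : Fin N → V), Injective vtx ∧ (∀ s ∈ K.faces, ∀ v ∈ s, ∃ i, vtx i = v) ∧
      ∀ i, ∃ s ∈ K.faces, vtx i ∈ s := by
  have hVfin : (⋃ s ∈ K.faces, (s : Set V)).Finite := hfin.biUnion fun s _ => s.finite_toSet
  obtain ⟨N, f, hf⟩ := hVfin.fin_embedding
  refine ⟨N, f, f.injective, fun s hs v hv => ?_, fun i => ?_⟩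
  · have : v ∈ Set.range f := by
      rw [hf]
      exact Set.mem_biUnion hs hv
    exact this
  · have : f i ∈ ⋃ s ∈ K.faces, (s : Set V) := by
      rw [← hf]
      exact ⟨i, rfl⟩
    simpa using this

end Enumeration

end Literature.Analysis.Convexity
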